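import Mathlib
import HarnessLib

/-!
# The incomplete gamma function of integer order: `P(n+1, z) = 1 − e^{−z} Σ_{k≤n} z^k/k!`

Topic `Literature/Analysis/SpecialFunctions`.  Theorems only (no definitions, no named facts).

**The printed statements** (NIST DLMF §8.2, §8.4(ii)): `γ(a,z) = ∫₀^z t^{a−1} e^{−t} dt` (8.2.1),
`P(a,z) = γ(a,z)/Γ(a)` (8.2.4); for `n = 0, 1, 2, …`, with `e_n(z) = Σ_{k=0}^{n} z^k/k!` (8.4.11):
`γ(n+1,z) = n!(1 − e^{−z} e_n(z))` (8.4.7), `P(n+1,z) = 1 − e^{−z} e_n(z)` (8.4.9),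
`Q(n+1,z) = e^{−z} e_n(z)` (8.4.10).

Probabilistic reading (the form consumers use): `P(n+1, z)` is the `Gamma(n+1,1)` = Erlang-`(n+1)` CDF
at `z`, and (8.4.9) is the Erlang–Poisson duality `P(Γ_{n+1} ≤ z) = P(Poisson(z) ≥ n+1)`.

What is proved (`z ≥ 0`, over set / interval integrals of `t^n e^{−t}/n!`):
* `hasDerivAt_expPartialSum` — `e_n' = e_{n−1}`;
* `integral_pow_mul_exp_neg_div_factorial_Ioc` — (8.4.9): `∫_{(0,z]} t^n e^{−t}/n! = 1 − e^{−z} e_n(z)`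
  (also as `∫ in 0..z`, `intervalIntegral_pow_mul_exp_neg_div_factorial`);
* `integral_pow_mul_exp_neg_div_factorial_Ioi` — `∫_{(0,∞)} t^n e^{−t}/n! = 1` (`Γ(n+1) = n!`);
* `integral_pow_mul_exp_neg_div_factorial_Ioi_eq_tail` — (8.4.10): `∫_{(z,∞)} t^n e^{−t}/n! = e^{−z} e_n(z)`;
* bounds `0 ≤ P(n+1,z) ≤ 1`, and the Poisson normalisation `Σ_j e^{−λ} λ^j/j! = 1`.

(Cell qa-cr context: line `score-shape-universality`, stub `stub_perT`, manipulates the Poisson mixture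
of these Erlang CDFs. HONEST FRAMING: classical special functions; nothing here bears on any
quantum-advantage claim.)
-/

noncomputable section

namespace Literature.Analysis.SpecialFunctions

open MeasureTheory Set Real

/-- `d/dz e_n(z) = e_{n−1}(z)`, i.e. `d/dz Σ_{k<n+1} z^k/k! = Σ_{k<n} z^k/k!`. [cite: DLMF, §8.4 eq. 8.4.11] -/
theorem hasDerivAt_expPartialSum (n : ℕ) (z : ℝ) :
    HasDerivAt (fun z : ℝ => ∑ k ∈ Finset.range (n + 1), z ^ k / (k.factorial : ℝ))
      (∑ k ∈ Finset.range n, z ^ k / (k.factorial : ℝ)) z := by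
  have h : HasDerivAt (fun z : ℝ => ∑ k ∈ Finset.range (n + 1), z ^ k / (k.factorial : ℝ))
      (∑ k ∈ Finset.range (n + 1), ((k : ℝ) * z ^ (k - 1)) / (k.factorial : ℝ)) z := by
    apply HasDerivAt.fun_sum
    intro k _
    exact (hasDerivAt_pow k z).div_const _
  refine h.congr_deriv ?_
  rw [Finset.sum_range_succ']
  simp only [Nat.cast_zero, zero_mul, zero_div, add_zero]
  refine Finset.sum_congr rfl fun k _ => ?_
  rw [Nat.factorial_succ, Nat.cast_mul, Nat.add_sub_cancel]
  have hk : ((k.factorial : ℕ) : ℝ) ≠ 0 := by positivity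
  have hk1 : ((k + 1 : ℕ) : ℝ) ≠ 0 := by positivity
  field_simp

/-- `e_n(0) = 1`. [cite: DLMF, §8.4 eq. 8.4.11] -/
theorem expPartialSum_zero (n : ℕ) : ∑ k ∈ Finset.range (n + 1), (0:ℝ) ^ k / (k.factorial : ℝ) = 1 := by
  rw [Finset.sum_range_succ']
  simp

/-- **DLMF 8.4.9 (with 8.2.1, 8.2.4)**: `P(n+1, z) = ∫₀^z t^n e^{−t} dt / n! = 1 − e^{−z} Σ_{k=0}^{n} z^k/k!`
(interval-integral form; as an identity of antiderivatives it holds for every real `z`).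
[cite: DLMF, §8.4 eq. 8.4.9] -/
theorem intervalIntegral_pow_mul_exp_neg_div_factorial (n : ℕ) (z : ℝ) :
    ∫ t in (0:ℝ)..z, t ^ n * exp (-t) / (n.factorial : ℝ)
      = 1 - exp (-z) * ∑ k ∈ Finset.range (n + 1), z ^ k / (k.factorial : ℝ) := by
  have hH : ∀ t ∈ uIcc (0:ℝ) z,
      HasDerivAt (fun t : ℝ => 1 - exp (-t) * ∑ k ∈ Finset.range (n + 1), t ^ k / (k.factorial : ℝ))
        (t ^ n * exp (-t) / (n.factorial : ℝ)) t := by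
    intro t _
    have h1 : HasDerivAt (fun t : ℝ => exp (-t)) (exp (-t) * -1) t := (hasDerivAt_neg t).exp
    have h3 := (h1.fun_mul (hasDerivAt_expPartialSum n t)).const_sub (1:ℝ)
    refine h3.congr_deriv ?_
    rw [Finset.sum_range_succ]
    ring
  rw [intervalIntegral.integral_eq_sub_of_hasDerivAt hH
    (Continuous.intervalIntegrable (by fun_prop) _ _)]
  simp [expPartialSum_zero]

/-- **DLMF 8.4.9, set-integral form**: `∫_{(0,z]} t^n e^{−t}/n! dt = 1 − e^{−z} Σ_{k=0}^{n} z^k/k!` for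
`z ≥ 0` — the Erlang-`(n+1)` (`Gamma(n+1,1)`) distribution function. [cite: DLMF, §8.4 eq. 8.4.9] -/
theorem integral_pow_mul_exp_neg_div_factorial_Ioc (n : ℕ) {z : ℝ} (hz : 0 ≤ z) :
    ∫ t in Ioc (0:ℝ) z, t ^ n * exp (-t) / (n.factorial : ℝ)
      = 1 - exp (-z) * ∑ k ∈ Finset.range (n + 1), z ^ k / (k.factorial : ℝ) := by
  rw [← intervalIntegral.integral_of_le hz, intervalIntegral_pow_mul_exp_neg_div_factorial n z]

/-- `∫_{(0,∞)} t^n e^{−t}/n! dt = 1` (`Γ(n+1) = n!`, DLMF 8.2.1–8.2.2 at `z = 0`, 5.4.1).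
[cite: DLMF, §8.2 eqs. 8.2.1–8.2.2] -/
theorem integral_pow_mul_exp_neg_div_factorial_Ioi (n : ℕ) :
    ∫ t in Ioi (0:ℝ), t ^ n * exp (-t) / (n.factorial : ℝ) = 1 := by
  have h := integral_rpow_mul_exp_neg_mul_Ioi (a := (n:ℝ) + 1) (r := 1) (by positivity) one_pos
  simp only [add_sub_cancel_right, one_mul, one_div, inv_one, one_rpow] at h
  rw [Real.Gamma_nat_eq_factorial] at h
  have h' : ∫ t in Ioi (0:ℝ), t ^ n * exp (-t) = (n.factorial : ℝ) := by
    rw [← h]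
    refine setIntegral_congr_fun measurableSet_Ioi fun t _ => ?_
    rw [Real.rpow_natCast]
  have hn : (n.factorial : ℝ) ≠ 0 := by positivity
  simp_rw [div_eq_mul_inv]
  rw [integral_mul_const, h', mul_inv_cancel₀ hn]

/-- The integrand `t^n e^{−t}/n!` is nonnegative on `t ≥ 0`. [cite: DLMF, §8.2 eq. 8.2.1] -/
theorem pow_mul_exp_neg_div_factorial_nonneg (n : ℕ) {t : ℝ} (ht : 0 ≤ t) :
    0 ≤ t ^ n * exp (-t) / (n.factorial : ℝ) := by positivity

/-- `t^n e^{−t}/n!` is integrable on `(0, ∞)`. [cite: DLMF, §8.2 eq. 8.2.2] -/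
theorem integrableOn_pow_mul_exp_neg_div_factorial (n : ℕ) :
    IntegrableOn (fun t : ℝ => t ^ n * exp (-t) / (n.factorial : ℝ)) (Ioi 0) volume := by
  refine Integrable.of_integral_ne_zero ?_
  rw [integral_pow_mul_exp_neg_div_factorial_Ioi]; exact one_ne_zero

/-- `0 ≤ P(n+1, z)` (set-integral form, any real `z`). [cite: DLMF, §8.2 eq. 8.2.4] -/
theorem integral_pow_mul_exp_neg_div_factorial_Ioc_nonneg (n : ℕ) (z : ℝ) :
    0 ≤ ∫ t in Ioc (0:ℝ) z, t ^ n * exp (-t) / (n.factorial : ℝ) :=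
  setIntegral_nonneg measurableSet_Ioc fun _ ht => pow_mul_exp_neg_div_factorial_nonneg n ht.1.le

/-- `P(n+1, z) ≤ 1` (set-integral form, any real `z`). [cite: DLMF, §8.2 eq. 8.2.4] -/
theorem integral_pow_mul_exp_neg_div_factorial_Ioc_le_one (n : ℕ) (z : ℝ) :
    ∫ t in Ioc (0:ℝ) z, t ^ n * exp (-t) / (n.factorial : ℝ) ≤ 1 := by
  rw [← integral_pow_mul_exp_neg_div_factorial_Ioi n]
  have hf : 0 ≤ᵐ[volume.restrict (Ioi (0:ℝ))] (fun t : ℝ => t ^ n * exp (-t) / (n.factorial : ℝ)) := by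
    filter_upwards [ae_restrict_mem measurableSet_Ioi] with t ht
    exact pow_mul_exp_neg_div_factorial_nonneg n (le_of_lt ht)
  exact setIntegral_mono_set (integrableOn_pow_mul_exp_neg_div_factorial n) hf
    Ioc_subset_Ioi_self.eventuallyLE

/-- **DLMF 8.4.10**: `Q(n+1, z) = ∫_{(z,∞)} t^n e^{−t}/n! dt = e^{−z} Σ_{k=0}^{n} z^k/k!` for `z ≥ 0`.
[cite: DLMF, §8.4 eq. 8.4.10] -/
theorem integral_pow_mul_exp_neg_div_factorial_Ioi_eq_tail (n : ℕ) {z : ℝ} (hz : 0 ≤ z) :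
    ∫ t in Ioi z, t ^ n * exp (-t) / (n.factorial : ℝ)
      = exp (-z) * ∑ k ∈ Finset.range (n + 1), z ^ k / (k.factorial : ℝ) := by
  have hsplit := setIntegral_union (μ := volume)
    (f := fun t : ℝ => t ^ n * exp (-t) / (n.factorial : ℝ))
    (Set.disjoint_left.2 fun t (ht : t ∈ Ioc (0:ℝ) z) (ht' : t ∈ Ioi z) => (not_lt.2 ht.2) ht')
    measurableSet_Ioi
    ((integrableOn_pow_mul_exp_neg_div_factorial n).mono_set Ioc_subset_Ioi_self)
    ((integrableOn_pow_mul_exp_neg_div_factorial n).mono_set (Ioi_subset_Ioi hz))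
  rw [Ioc_union_Ioi_eq_Ioi hz, integral_pow_mul_exp_neg_div_factorial_Ioi,
    integral_pow_mul_exp_neg_div_factorial_Ioc n hz] at hsplit
  linarith

/-- The Poisson weights `e^{−λ} λ^j/j!` are nonnegative for `λ ≥ 0`. [cite: DLMF, §4.2 eq. 4.2.19] -/
theorem exp_neg_mul_pow_div_factorial_nonneg {lam : ℝ} (hlam : 0 ≤ lam) (j : ℕ) :
    0 ≤ exp (-lam) * lam ^ j / (j.factorial : ℝ) := by positivity

/-- Poisson normalisation `Σ_j e^{−λ} λ^j/j! = 1` (the exponential series, DLMF 4.2.19).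
[cite: DLMF, §4.2 eq. 4.2.19] -/
theorem hasSum_exp_neg_mul_pow_div_factorial (lam : ℝ) :
    HasSum (fun j : ℕ => exp (-lam) * lam ^ j / (j.factorial : ℝ)) 1 := by
  have h : HasSum (fun j : ℕ => lam ^ j / (j.factorial : ℝ)) (exp lam) := by
    have := NormedSpace.expSeries_div_hasSum_exp lam
    rwa [← congrFun Real.exp_eq_exp_ℝ lam] at this
  have h2 := h.mul_left (exp (-lam))
  rw [← Real.exp_add, neg_add_cancel, Real.exp_zero] at h2
  have h3 : (fun j : ℕ => exp (-lam) * lam ^ j / (j.factorial : ℝ))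
      = fun j => exp (-lam) * (lam ^ j / (j.factorial : ℝ)) := by
    funext j; ring
  rw [h3]; exact h2

end Literature.Analysis.SpecialFunctions

end
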